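import Literature.Computability.Complexity.QBFArithmetization
import Mathlib.Data.Fintype.Sum
import Mathlib.Data.Fintype.Prod
import Mathlib.Logic.Equiv.Fin.Basic
import HarnessLib

/-!
# Trevisan–Vadhan's universal arithmetized QBF (TV07 Lemma 4.1): ONE polynomial family per size `n`
# handling every prenex CNF formula with `n` variables and `n` clauses — and every quantifier prefix

Literature / complexity — derandomization (Case 2 of IW98 in TV07 form), sequel of
`QBFArithmetization.lean`. Trevisan–Vadhan make the `IP = PSPACE` polynomials independent of the
instance by arithmetizing a UNIVERSAL quantified formula `Φ_n` with free variables `y_{jk}, z_{jk}`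
("`y_{jk} = 1` iff the `j`-th clause contains `x_k`, `z_{jk} = 1` iff it contains `¬x_k`", TV07
(4.1)–(4.2)), so that every stage `f_{n,i}` is a fixed polynomial in `(y, z, x)`. Here, in addition,
the QUANTIFIER PREFIX is arithmetized by selector variables `s_k` (`s_k = 1`: `∀x_k`, `s_k = 0`: `∃x_k`;
the quantifier step is `s_k · Π + (1 − s_k) · ∐`, linear in `s_k`), so that no normal form of the prefix
is needed: the family handles every prenex CNF instance with `n` variables, `≤ n` clauses and any
prefix.

* `QBFUniv.UVar n` — the variables `y_{jk}, z_{jk}, x_k, s_k` (`2n² + 2n` of them), laid out in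
  `Fin (N n)` by the EXPLICIT `QBFUniv.lay` (`lay_y_val`, `lay_z_val`, `lay_x_val`, `lay_s_val`: positions
  `k + nj`, `n² + k + nj`, `2n² + k`, `2n² + n + k`);
* `QBFUniv.matrixPoly n` — the arithmetized universal CNF matrix
  `Π_j (1 − Π_k (1 − y_{jk} x_k)(1 − z_{jk} (1 − x_k)))`; `eval_matrixPoly_ubv`: on Boolean points it
  is the indicator of `CNFHolds` ("clause `j` has a true literal for every `j`"); `degreeOf_matrixPoly_le`
  (degree `≤ 2n` in every variable);
* `QBFUniv.opQ s j` — the selected quantifier step, `eval_opQ` (downward evaluation from two values),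
  `eval_opQ_boolVal`, `degreeOf_opQ_le`;
* `QBFUniv.UOp`, `QBFUniv.uops n`, **`QBFUniv.fam n i`** — the fine schedule (for `k = 0, …, n−1`:
  the quantifier step on `x_k` selected by `s_k`, then the linearization of every variable) and the
  family `f_{n,i}`; **`fam_succ`** (`f_{n,i} = op_i (f_{n,i+1})`: downward self-reducibility, TV07
  Lemma 4.1 (i), with `eval_applyU` the two-query evaluation), `fam_of_length_le` (`f_{n,m} =` the matrix),
  `length_uops` (`m(n) = n (N n + 1)`);
* **`degreeOf_fam_le`**, **`totalDegree_fam_le`** — every `f_{n,i}` has degree `≤ max 3 (2n)` in every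
  variable, so total degree `≤ (2n² + 2n) · max 3 (2n)` (TV07 Lemma 4.1 (iii));
* **`eval_fam_zero_ubv`** — on a Boolean point `b`, `f_{n,0}(b) = [HoldsL b [0, …, n−1]]`, the truth value of the
  prenex formula whose prefix is read off the `s`-bits, matrix off the `y, z`-bits (TV07 Lemma 4.1,
  first bullet / (4.2), the semantic half of the `PSPACE`-hardness (ii)).

Everything is proved; definitions are plain (no named facts). The Karp reduction from `TQBF`
(`PSPACE`-hardness proper), the Booleanization `F` with its length function `h(n, i)` (TV07 Thm. 4.3)
and the machines are separate files.

## References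

* [TrevisanVadhan2007] L. Trevisan, S. Vadhan, Comput. Complexity 16 (2007), §4: Lemma 4.1 with its
  proof sketch ((4.1), (4.2): the universal formula `Φ_n`, "by inspection `Φ_n(y(φ), z(φ)) ≡ φ`"),
  Thm. 4.3 (held text pp. 12–13).
* [AroraBarakCC2009] S. Arora, B. Barak, CUP 2009, §8.3.1 (arithmetization of CNF formulas:
  `x ↦ x`, `¬x ↦ 1 − x`, clause `↦ 1 − Π(1 − ℓ)`), §8.3.3 (the `IP = PSPACE` operators).
-/

noncomputable section

namespace Literature.Computability.Complexity

namespace QBFUniv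

open MvPolynomial Finset QBFArith

variable {R : Type*} [CommRing R]

/-! ### Variables and their layout -/

/-- The variables of the universal formula of size `n`: clause-description bits `y_{jk}` ("clause `j`
contains `x_k`"), `z_{jk}` ("clause `j` contains `¬x_k`"), the quantified variables `x_k`, and the
quantifier selectors `s_k`. [cite: TrevisanVadhan2007, §4 (4.1)] -/
inductive UVar (n : ℕ) : Type
  | y (j k : Fin n) : UVar n
  | z (j k : Fin n) : UVar n
  | x (k : Fin n) : UVar n
  | s (k : Fin n) : UVar n
  deriving DecidableEq

/-- The variables as a sum of products of `Fin n`. [folklore] -/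
def UVar.equivSum (n : ℕ) : UVar n ≃ ((Fin n × Fin n) ⊕ (Fin n × Fin n)) ⊕ (Fin n ⊕ Fin n) where
  toFun
    | .y j k => Sum.inl (Sum.inl (j, k))
    | .z j k => Sum.inl (Sum.inr (j, k))
    | .x k => Sum.inr (Sum.inl k)
    | .s k => Sum.inr (Sum.inr k)
  invFun
    | Sum.inl (Sum.inl (j, k)) => .y j k
    | Sum.inl (Sum.inr (j, k)) => .z j k
    | Sum.inr (Sum.inl k) => .x k
    | Sum.inr (Sum.inr k) => .s k
  left_inv v := by cases v <;> rfl
  right_inv w := by rcases w with ((⟨j, k⟩ | ⟨j, k⟩) | (k | k)) <;> rfl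

/-- The variables form a finite type. [folklore] -/
instance (n : ℕ) : Fintype (UVar n) := Fintype.ofEquiv _ (UVar.equivSum n).symm

/-- The number of variables: `N n = 2n² + 2n`. [cite: TrevisanVadhan2007, §4 ("`Φ_n` has `2n²` free variables")] -/
def N (n : ℕ) : ℕ := Fintype.card (UVar n)

/-- `N n = 2n² + 2n`. [folklore] -/
theorem N_eq (n : ℕ) : N n = 2 * (n * n) + 2 * n := by
  rw [N, Fintype.card_congr (UVar.equivSum n)]
  simp only [Fintype.card_sum, Fintype.card_prod, Fintype.card_fin]
  ring

/-- **The explicit layout** of the variables in `Fin (2n² + 2n)`: `y_{jk} ↦ k + n·j`, `z_{jk} ↦ n² + k + n·j`,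
`x_k ↦ 2n² + k`, `s_k ↦ 2n² + n + k` (the order of `UVar.equivSum` through Mathlib's `finProdFinEquiv` /
`finSumFinEquiv`) — explicit so that machines can locate the blocks of a point. [folklore] -/
def layExplicit (n : ℕ) : UVar n ≃ Fin (2 * (n * n) + 2 * n) :=
  (UVar.equivSum n).trans
    (((Equiv.sumCongr finProdFinEquiv finProdFinEquiv).sumCongr (Equiv.refl (Fin n ⊕ Fin n))).trans
      ((Equiv.sumCongr finSumFinEquiv finSumFinEquiv).trans (finSumFinEquiv.trans (finCongr (by ring)))))

/-- The layout of the variables in `Fin (N n)` (`layExplicit` transported along `N_eq`). [folklore] -/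
def lay (n : ℕ) : UVar n ≃ Fin (N n) := (layExplicit n).trans (finCongr (N_eq n).symm)

/-- Position of `y_{jk}`: `k + n·j`. [folklore] -/
@[simp] theorem lay_y_val {n : ℕ} (j k : Fin n) : (lay n (.y j k)).val = k.val + n * j.val := by
  simp [lay, layExplicit, UVar.equivSum, finProdFinEquiv]

/-- Position of `z_{jk}`: `n² + k + n·j`. [folklore] -/
@[simp] theorem lay_z_val {n : ℕ} (j k : Fin n) : (lay n (.z j k)).val = n * n + (k.val + n * j.val) := by
  simp [lay, layExplicit, UVar.equivSum, finProdFinEquiv]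
  omega

/-- Position of `x_k`: `2n² + k`. [folklore] -/
@[simp] theorem lay_x_val {n : ℕ} (k : Fin n) : (lay n (.x k)).val = 2 * (n * n) + k.val := by
  simp [lay, layExplicit, UVar.equivSum]
  ring

/-- Position of `s_k`: `2n² + n + k`. [folklore] -/
@[simp] theorem lay_s_val {n : ℕ} (k : Fin n) : (lay n (.s k)).val = 2 * (n * n) + n + k.val := by
  simp [lay, layExplicit, UVar.equivSum]
  ring

/-- The variable `v` as a polynomial. [folklore] -/
abbrev V {n : ℕ} (v : UVar n) : MvPolynomial (Fin (N n)) R := X (lay n v)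

/-! ### The universal CNF matrix -/

section Matrix

variable (R) (n : ℕ)

/-- The factor of literal position `(j, k)`: `(1 − y_{jk} x_k)(1 − z_{jk}(1 − x_k))` — `0` iff clause `j`
contains a literal on `x_k` made true. [cite: AroraBarakCC2009, §8.3.1] -/
def litFactor (j k : Fin n) : MvPolynomial (Fin (N n)) R :=
  (1 - V (.y j k) * V (.x k)) * (1 - V (.z j k) * (1 - V (.x k)))

/-- The arithmetized clause `j`: `1 − Π_k litFactor j k`. [cite: AroraBarakCC2009, §8.3.1] -/
def clausePoly (j : Fin n) : MvPolynomial (Fin (N n)) R :=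
  1 - ∏ k : Fin n, litFactor R n j k

/-- **The arithmetized universal matrix** `Π_j clausePoly j` (TV07's `Φ_n` without its quantifiers,
arithmetized as in the `IP = PSPACE` protocol). [cite: TrevisanVadhan2007, §4 (4.1)] -/
def matrixPoly : MvPolynomial (Fin (N n)) R :=
  ∏ j : Fin n, clausePoly R n j

variable {R n}

/-- The literal at position `(j, k)` of the described CNF is true under the assignment `b`. [folklore] -/
def LitTrue (b : UVar n → Bool) (j k : Fin n) : Prop :=
  (b (.y j k) = true ∧ b (.x k) = true) ∨ (b (.z j k) = true ∧ b (.x k) = false)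

/-- **The described CNF holds**: every clause has a true literal. [cite: TrevisanVadhan2007, §4 (4.2)] -/
def CNFHolds (b : UVar n → Bool) : Prop := ∀ j : Fin n, ∃ k : Fin n, LitTrue b j k

/-- Truth of a literal position is decidable. [folklore] -/
instance (b : UVar n → Bool) (j k : Fin n) : Decidable (LitTrue b j k) := by unfold LitTrue; infer_instance

/-- Truth of the described CNF is decidable. [folklore] -/
instance (b : UVar n → Bool) : Decidable (CNFHolds b) := by unfold CNFHolds; infer_instance

/-- The Boolean point of an assignment of the universal variables. [folklore] -/
def ubv (b : UVar n → Bool) : Fin (N n) → R := bv (b ∘ (lay n).symm)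

/-- Value of a variable at a Boolean point. [folklore] -/
@[simp] theorem eval_V_ubv (b : UVar n → Bool) (v : UVar n) :
    eval (ubv (R := R) b) (V v) = if b v then 1 else 0 := by
  simp [ubv, bv, V]

/-- Products of indicators. [folklore] -/
theorem prod_indicator {ι : Type*} (s : Finset ι) (P : ι → Prop) [DecidablePred P] :
    (∏ i ∈ s, (if P i then (1 : R) else 0)) = if ∀ i ∈ s, P i then 1 else 0 := by
  classical
  induction s using Finset.induction_on with
  | empty => simp
  | insert a s ha ih =>
    rw [prod_insert ha, ih]
    by_cases hPa : P a <;> by_cases hs : ∀ i ∈ s, P i <;> simp [hPa, hs]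

/-- The literal factor at a Boolean point is the indicator of "the literal position is NOT made true".
[cite: AroraBarakCC2009, §8.3.1] -/
theorem eval_litFactor_ubv (b : UVar n → Bool) (j k : Fin n) :
    eval (ubv (R := R) b) (litFactor R n j k) = if LitTrue b j k then 0 else 1 := by
  simp only [litFactor, map_mul, map_sub, map_one, eval_V_ubv, LitTrue]
  rcases Bool.eq_false_or_eq_true (b (.y j k)) with hy | hy <;>
    rcases Bool.eq_false_or_eq_true (b (.z j k)) with hz | hz <;>
      rcases Bool.eq_false_or_eq_true (b (.x k)) with hx | hx <;> simp [hy, hz, hx]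

/-- The arithmetized clause at a Boolean point is the indicator of "some literal of clause `j` is true".
[cite: AroraBarakCC2009, §8.3.1] -/
theorem eval_clausePoly_ubv (b : UVar n → Bool) (j : Fin n) :
    eval (ubv (R := R) b) (clausePoly R n j) = if ∃ k, LitTrue b j k then 1 else 0 := by
  rw [clausePoly, map_sub, map_one, map_prod]
  simp_rw [eval_litFactor_ubv]
  have e : (∏ k : Fin n, (if LitTrue b j k then (0 : R) else 1)) = ∏ k : Fin n, (if ¬ LitTrue b j k then (1 : R) else 0) :=
    prod_congr rfl fun k _ => by split_ifs <;> simp_all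
  rw [e, prod_indicator]
  by_cases h : ∃ k, LitTrue b j k
  · rw [if_pos h, if_neg (by push Not; simpa using h)]; ring
  · rw [if_neg h, if_pos (by simpa using h)]; ring

/-- **The universal matrix at a Boolean point is the indicator of the described CNF**
(TV07 (4.2): "by inspection, `Φ_n(y(φ), z(φ)) ≡ φ`", matrix part). [cite: TrevisanVadhan2007, §4 (4.2)] -/
theorem eval_matrixPoly_ubv (b : UVar n → Bool) :
    eval (ubv (R := R) b) (matrixPoly R n) = if CNFHolds b then 1 else 0 := by
  rw [matrixPoly, map_prod]
  simp_rw [eval_clausePoly_ubv]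
  rw [prod_indicator]
  simp [CNFHolds]

/-! #### Degrees of the matrix -/

variable [Nontrivial R]

/-- Degree of a variable polynomial. [folklore] -/
theorem degreeOf_V (i : Fin (N n)) (v : UVar n) : degreeOf i (V (R := R) v) = if i = lay n v then 1 else 0 := by
  by_cases h : i = lay n v
  · rw [if_pos h, h]; exact degreeOf_X_self _
  · rw [if_neg h]; exact degreeOf_X_of_ne h

omit [Nontrivial R] in
/-- `1 - q` has the degrees of `q`. [folklore] -/
theorem degreeOf_one_sub_le (i : Fin (N n)) (q : MvPolynomial (Fin (N n)) R) :
    degreeOf i (1 - q) ≤ degreeOf i q := by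
  refine (degreeOf_sub_le _ _ _).trans ?_
  rw [degreeOf_one]; exact max_le (Nat.zero_le _) le_rfl

/-- Degrees of a literal factor: `≤ 2` in `x_k`, `≤ 1` in `y_{jk}`, `z_{jk}`, `0` elsewhere — in any case
`≤ (if i = x_k then 2 else [i ∈ {y_{jk}, z_{jk}}])`. [folklore] -/
theorem degreeOf_litFactor_le (i : Fin (N n)) (j k : Fin n) :
    degreeOf i (litFactor R n j k) ≤
      (if i = lay n (.x k) then 2 else 0) + (if i = lay n (.y j k) then 1 else 0) + (if i = lay n (.z j k) then 1 else 0) := by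
  rw [litFactor]
  refine (degreeOf_mul_le _ _ _).trans ?_
  have h1 : degreeOf i (1 - V (R := R) (UVar.y j k) * V (.x k)) ≤
      (if i = lay n (.y j k) then 1 else 0) + (if i = lay n (.x k) then 1 else 0) := by
    refine (degreeOf_one_sub_le _ _).trans ((degreeOf_mul_le _ _ _).trans ?_)
    rw [degreeOf_V, degreeOf_V]
  have h2 : degreeOf i (1 - V (R := R) (UVar.z j k) * (1 - V (.x k))) ≤
      (if i = lay n (.z j k) then 1 else 0) + (if i = lay n (.x k) then 1 else 0) := by
    refine (degreeOf_one_sub_le _ _).trans ((degreeOf_mul_le _ _ _).trans ?_)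
    rw [degreeOf_V]
    exact Nat.add_le_add_left ((degreeOf_one_sub_le _ _).trans (by rw [degreeOf_V])) _
  refine (Nat.add_le_add h1 h2).trans ?_
  split_ifs <;> omega

/-- **Every clause polynomial has degree `≤ 2` in every variable.** [cite: TrevisanVadhan2007, Lemma 4.1 (iii)] -/
theorem degreeOf_clausePoly_le (i : Fin (N n)) (j : Fin n) : degreeOf i (clausePoly R n j) ≤ 2 := by
  rw [clausePoly]
  refine (degreeOf_one_sub_le _ _).trans ((degreeOf_prod_le _ _ _).trans ?_)
  refine (Finset.sum_le_sum fun k _ => degreeOf_litFactor_le i j k).trans ?_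
  obtain ⟨v₀, rfl⟩ : ∃ v₀, i = lay n v₀ := ⟨(lay n).symm i, by simp⟩
  simp only [EmbeddingLike.apply_eq_iff_eq]
  cases v₀ with
  | y j' k' =>
    by_cases hj : j' = j
    · subst hj; simp
    · simp [hj]
  | z j' k' =>
    by_cases hj : j' = j
    · subst hj; simp
    · simp [hj]
  | x k' => simp
  | s k' => simp

/-- **The matrix has degree `≤ 2n` in every variable.** [cite: TrevisanVadhan2007, Lemma 4.1 (iii)] -/
theorem degreeOf_matrixPoly_le (i : Fin (N n)) : degreeOf i (matrixPoly R n) ≤ 2 * n := by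
  rw [matrixPoly]
  refine (degreeOf_prod_le _ _ _).trans ?_
  refine (Finset.sum_le_sum fun j _ => degreeOf_clausePoly_le i j).trans ?_
  rw [sum_const, card_univ, Fintype.card_fin, smul_eq_mul, mul_comm]

end Matrix

/-! ### The selected quantifier step -/

section Quant

variable {M : ℕ}

/-- **The quantifier step selected by a variable** `X_s`: `X_s · (p[0] p[1]) + (1 − X_s)(1 − (1−p[0])(1−p[1]))`
— the `∀`-operator where `X_s = 1`, the `∃`-operator where `X_s = 0`, and linear in `X_s`.
[cite: TrevisanVadhan2007, Lemma 4.1 (proof: the rule used depends on `i` and `n`; here read off `s`)] -/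
def opQ (sIdx j : Fin M) (p : MvPolynomial (Fin M) R) : MvPolynomial (Fin M) R :=
  X sIdx * opAll j p + (1 - X sIdx) * opEx j p

/-- **Downward evaluation of the selected quantifier step** (two values of `p`).
[cite: TrevisanVadhan2007, Lemma 4.1 (i)] -/
theorem eval_opQ (sIdx j : Fin M) (p : MvPolynomial (Fin M) R) (v : Fin M → R) :
    eval v (opQ sIdx j p) =
      v sIdx * (eval (Function.update v j 0) p * eval (Function.update v j 1) p) +
        (1 - v sIdx) * (1 - (1 - eval (Function.update v j 0) p) * (1 - eval (Function.update v j 1) p)) := by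
  simp only [opQ, map_add, map_mul, map_sub, map_one, eval_X, eval_opAll, eval_opEx]

/-- On `{0,1}`-values the selected step is `∧` (selector `1`) or `∨` (selector `0`) over `X_j ∈ {0,1}`.
[cite: AroraBarakCC2009, §8.3.1] -/
theorem eval_opQ_boolVal (sIdx j : Fin M) (p : MvPolynomial (Fin M) R) (v : Fin M → R) {P₀ P₁ : Prop}
    [Decidable P₀] [Decidable P₁] (sel : Bool) (hs : v sIdx = if sel then 1 else 0)
    (h0 : eval (Function.update v j 0) p = if P₀ then 1 else 0)
    (h1 : eval (Function.update v j 1) p = if P₁ then 1 else 0) :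
    eval v (opQ sIdx j p) = if (if sel then P₀ ∧ P₁ else P₀ ∨ P₁) then 1 else 0 := by
  rw [eval_opQ, hs, h0, h1]
  cases sel <;> by_cases hP₀ : P₀ <;> by_cases hP₁ : P₁ <;> simp [hP₀, hP₁]

/-- Degrees of the selected step: `+1` in the selector, `X_j` removed, the rest at most doubled.
[cite: TrevisanVadhan2007, Lemma 4.1 (iii)] -/
theorem degreeOf_opQ_le [Nontrivial R] (i sIdx j : Fin M) (p : MvPolynomial (Fin M) R) :
    degreeOf i (opQ sIdx j p) ≤ (if i = sIdx then 1 else 0) + (if i = j then 0 else 2 * degreeOf i p) := by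
  rw [opQ]
  have hX : degreeOf i (X sIdx : MvPolynomial (Fin M) R) ≤ if i = sIdx then 1 else 0 := by
    by_cases h : i = sIdx
    · rw [if_pos h, h, degreeOf_X_self]
    · rw [if_neg h, degreeOf_X_of_ne h]
  have h1X : degreeOf i (1 - X sIdx : MvPolynomial (Fin M) R) ≤ if i = sIdx then 1 else 0 := by
    refine (degreeOf_sub_le _ _ _).trans ?_
    rw [degreeOf_one]; exact max_le (Nat.zero_le _) hX
  refine (degreeOf_add_le _ _ _).trans (max_le ?_ ?_)
  · exact (degreeOf_mul_le _ _ _).trans (Nat.add_le_add hX (degreeOf_opAll_le i j p))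
  · exact (degreeOf_mul_le _ _ _).trans (Nat.add_le_add h1X (degreeOf_opEx_le i j p))

end Quant

/-! ### The fine schedule and the family `f_{n,i}` -/

section Family

variable (R) (n : ℕ)

/-- An operator of the fine schedule: the selected quantifier step on `x_k`, or the linearization of
one variable. [cite: TrevisanVadhan2007, Lemma 4.1 (proof)] -/
inductive UOp (n : ℕ) : Type
  | quant (k : Fin n) : UOp n
  | lin (i : Fin (N n)) : UOp n

variable {R n} in
/-- Applying one operator of the fine schedule. [cite: TrevisanVadhan2007, Lemma 4.1 (proof)] -/
def applyU : UOp n → MvPolynomial (Fin (N n)) R → MvPolynomial (Fin (N n)) R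
  | .quant k => opQ (lay n (.s k)) (lay n (.x k))
  | .lin i => opLin i

/-- The block of `x_k`: its quantifier step, preceded (to the right) by the linearization of every
variable. [cite: TrevisanVadhan2007, Lemma 4.1 (proof)] -/
def ublockOps (k : Fin n) : List (UOp n) := UOp.quant k :: (List.finRange (N n)).map UOp.lin

/-- **The fine schedule**: the blocks of `x_0, x_1, …, x_{n-1}` (outermost first), `n (N n + 1)`
operators. [cite: TrevisanVadhan2007, Lemma 4.1 (the sequence `f_{n,0}, …, f_{n,m(n)}`)] -/
def uops : List (UOp n) := ((List.finRange n).map (ublockOps n)).flatten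

/-- **The family `f_{n,i}`**: the operators `i, i+1, …` of the fine schedule applied (from the right)
to the universal matrix; `f_{n,m(n)}` is the matrix. [cite: TrevisanVadhan2007, Lemma 4.1] -/
def fam (i : ℕ) : MvPolynomial (Fin (N n)) R := ((uops n).drop i).foldr applyU (matrixPoly R n)

/-- The length of the fine schedule: `m(n) = n (N n + 1)`. [folklore] -/
theorem length_uops : (uops n).length = n * (N n + 1) := by
  simp [uops, ublockOps, List.length_flatten, Function.comp_def]

variable {R n}

/-- Past the schedule the family is the matrix (`f_{n,m} = Φ̃`). [cite: TrevisanVadhan2007, Lemma 4.1 (i) ("`f_{n,m(n)}` can be evaluated in time poly")] -/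
theorem fam_of_length_le {i : ℕ} (hi : (uops n).length ≤ i) : fam R n i = matrixPoly R n := by
  rw [fam, List.drop_eq_nil_of_le hi, List.foldr_nil]

/-- **Downward self-reducibility** (TV07 Lemma 4.1 (i)): `f_{n,i} = op_i (f_{n,i+1})` for `i < m(n)`,
each operator needing two values of `f_{n,i+1}` (`eval_applyU`). [cite: TrevisanVadhan2007, Lemma 4.1 (i)] -/
theorem fam_succ {i : ℕ} (hi : i < (uops n).length) : fam R n i = applyU ((uops n)[i]) (fam R n (i + 1)) := by
  rw [fam, fam, List.drop_eq_getElem_cons hi, List.foldr_cons]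

/-- **The two-query evaluation of one operator**: the value of `applyU o p` at `v` from the values of `p`
at `v[j ↦ 0]` and `v[j ↦ 1]`, `j` the variable the operator acts on. [cite: TrevisanVadhan2007, Lemma 4.1 (i)] -/
theorem eval_applyU (o : UOp n) (p : MvPolynomial (Fin (N n)) R) (v : Fin (N n) → R) :
    eval v (applyU o p) =
      match o with
      | .quant k => v (lay n (.s k)) * (eval (Function.update v (lay n (.x k)) 0) p * eval (Function.update v (lay n (.x k)) 1) p) +
          (1 - v (lay n (.s k))) * (1 - (1 - eval (Function.update v (lay n (.x k)) 0) p) * (1 - eval (Function.update v (lay n (.x k)) 1) p))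
      | .lin i => (1 - v i) * eval (Function.update v i 0) p + v i * eval (Function.update v i 1) p := by
  cases o with
  | quant k => exact eval_opQ _ _ p v
  | lin i => exact eval_opLin i p v

/-! #### Degrees of the family -/

/-- A list of linearizations of the fine schedule is the same fold as in `QBFArithmetization`. [folklore] -/
theorem foldr_lin_eq (l : List (Fin (N n))) (p : MvPolynomial (Fin (N n)) R) :
    (l.map UOp.lin).foldr applyU p = (l.map Op.lin).foldr applyOp p := by
  induction l with
  | nil => rfl
  | cons i l ih => simp only [List.map_cons, List.foldr_cons, applyU, applyOp, ih]

variable [Nontrivial R]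

/-- After linearizing the variables of `l`: those have degree `≤ 1`, no degree exceeds `max 1 d` if all
were `≤ d`. [cite: TrevisanVadhan2007, Lemma 4.1 (iii)] -/
theorem degreeOf_foldr_lin_le (l : List (Fin (N n))) (p : MvPolynomial (Fin (N n)) R) {d : ℕ}
    (hp : ∀ w, degreeOf w p ≤ d) (v : Fin (N n)) :
    degreeOf v ((l.map UOp.lin).foldr applyU p) ≤ max 1 d ∧
      (v ∈ l → degreeOf v ((l.map UOp.lin).foldr applyU p) ≤ 1) := by
  rw [foldr_lin_eq]
  induction l with
  | nil => exact ⟨(hp v).trans (le_max_right _ _), fun h => by simp at h⟩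
  | cons j l ih =>
    obtain ⟨ih1, ih2⟩ := ih
    simp only [List.map_cons, List.foldr_cons, applyOp]
    by_cases hvj : v = j
    · subst hvj
      exact ⟨(degreeOf_opLin_self_le _ _).trans (le_max_left _ _), fun _ => degreeOf_opLin_self_le _ _⟩
    · refine ⟨(degreeOf_opLin_le hvj _).trans ih1, fun h => (degreeOf_opLin_le hvj _).trans (ih2 ?_)⟩
      rcases List.mem_cons.1 h with h | h
      · exact absurd h hvj
      · exact h

/-- After whole blocks the degrees are `≤ max 3 (2n)`. [cite: TrevisanVadhan2007, Lemma 4.1 (iii)] -/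
theorem degreeOf_blocks_le (ks : List (Fin n)) (v : Fin (N n)) :
    degreeOf v ((((ks.map (ublockOps n)).flatten).foldr applyU (matrixPoly R n))) ≤ max 3 (2 * n) := by
  induction ks generalizing v with
  | nil => simpa using (degreeOf_matrixPoly_le (R := R) v).trans (le_max_right 3 (2 * n))
  | cons k ks ih =>
    simp only [List.map_cons, List.flatten_cons, ublockOps, List.cons_append, List.foldr_cons, List.foldr_append,
      applyU]
    set p' := ((ks.map (ublockOps n)).flatten).foldr applyU (matrixPoly R n)
    have hs : ∀ w, degreeOf w (((List.finRange (N n)).map UOp.lin).foldr applyU p') ≤ 1 := fun w =>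
      (degreeOf_foldr_lin_le _ p' ih w).2 (List.mem_finRange w)
    refine (degreeOf_opQ_le v _ _ _).trans ?_
    have := hs v
    split_ifs <;> omega

/-- **Every `f_{n,i}` has degree `≤ max 3 (2n)` in every variable.** [cite: TrevisanVadhan2007, Lemma 4.1 (iii)] -/
theorem degreeOf_fam_le (i : ℕ) (v : Fin (N n)) : degreeOf v (fam R n i) ≤ max 3 (2 * n) := by
  rw [fam, uops]
  suffices H : ∀ (ks : List (Fin n)) (i : ℕ) (v : Fin (N n)),
      degreeOf v (((((ks.map (ublockOps n)).flatten).drop i).foldr applyU (matrixPoly R n))) ≤ max 3 (2 * n) from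
    H _ i v
  intro ks
  induction ks with
  | nil => intro i v; simpa using (degreeOf_matrixPoly_le (R := R) v).trans (le_max_right 3 (2 * n))
  | cons k ks ih =>
    intro i v
    simp only [List.map_cons, List.flatten_cons]
    rw [List.drop_append]
    by_cases hi : i < (ublockOps n k).length
    · rw [Nat.sub_eq_zero_of_le hi.le, List.drop_zero, List.foldr_append]
      rcases i with _ | i
      · rw [List.drop_zero]
        have h := degreeOf_blocks_le (R := R) (k :: ks) v
        simpa [ublockOps, List.foldr_append] using h
      · simp only [ublockOps, List.drop_succ_cons]
        rw [← List.map_drop]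
        have hp' := degreeOf_blocks_le (R := R) ks
        exact ((degreeOf_foldr_lin_le _ _ hp' v).1).trans (max_le (by omega) le_rfl)
    · push Not at hi
      rw [List.drop_eq_nil_of_le hi, List.nil_append]
      exact ih _ v

/-- **Total degree of every `f_{n,i}`**: at most `N n · max 3 (2n)`, a polynomial in `n`
(TV07 Lemma 4.1 (iii)). [cite: TrevisanVadhan2007, Lemma 4.1 (iii)] -/
theorem totalDegree_fam_le (i : ℕ) : (fam R n i).totalDegree ≤ N n * max 3 (2 * n) :=
  totalDegree_le_of_degreeOf_le _ (degreeOf_fam_le i)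

/-! #### Boolean correctness of the family -/

omit [Nontrivial R]

/-- Updating the Boolean point at the layout of `v`. [folklore] -/
theorem update_ubv (b : UVar n → Bool) (v : UVar n) (c : Bool) :
    Function.update (ubv (R := R) b) (lay n v) (if c then 1 else 0) = ubv (Function.update b v c) := by
  rw [ubv, ubv, update_bv]
  congr 1
  funext i
  simp only [Function.comp_apply, Function.update_apply, Equiv.symm_apply_eq]

/-- **Semantics of the universal prenex formula** read off a Boolean assignment: quantify the
variables `x_k`, `k ∈ ks` (in order), `∀` where `s_k = 1` and `∃` where `s_k = 0`, over the described CNF.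
[cite: TrevisanVadhan2007, §4 (4.1)–(4.2)] -/
def HoldsL : (UVar n → Bool) → List (Fin n) → Prop
  | b, [] => CNFHolds b
  | b, k :: ks => if b (.s k) then ∀ c : Bool, HoldsL (Function.update b (.x k) c) ks
      else ∃ c : Bool, HoldsL (Function.update b (.x k) c) ks

open Classical in
/-- The polynomial after whole blocks, at a Boolean point, is the indicator of the prenex formula
quantifying the blocks' variables. [cite: TrevisanVadhan2007, Lemma 4.1 (first bullet)] -/
theorem eval_blocks_ubv (ks : List (Fin n)) (b : UVar n → Bool) :
    eval (ubv (R := R) b) ((((ks.map (ublockOps n)).flatten).foldr applyU (matrixPoly R n))) =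
      if HoldsL b ks then 1 else 0 := by
  induction ks generalizing b with
  | nil =>
    simp only [List.map_nil, List.flatten_nil, List.foldr_nil]
    rw [eval_matrixPoly_ubv]
    unfold HoldsL
    split_ifs <;> rfl
  | cons k ks ih =>
    simp only [List.map_cons, List.flatten_cons, ublockOps, List.cons_append, List.foldr_cons, List.foldr_append,
      applyU]
    set p' := ((ks.map (ublockOps n)).flatten).foldr applyU (matrixPoly R n)
    have hin : ∀ c : Bool, eval (Function.update (ubv (R := R) b) (lay n (.x k)) (if c then 1 else 0))
        (((List.finRange (N n)).map UOp.lin).foldr applyU p') = if HoldsL (Function.update b (.x k) c) ks then 1 else 0 := by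
      intro c
      rw [update_ubv, foldr_lin_eq, ubv, eval_foldr_lin_bv, ← ubv, ih]
    have h0 := hin false
    have h1 := hin true
    simp only [Bool.false_eq_true, ↓reduceIte] at h0 h1
    rw [eval_opQ_boolVal (lay n (.s k)) (lay n (.x k)) _ (ubv b) (b (.s k)) (by simp [ubv, bv]) h0 h1, HoldsL]
    congr 1
    cases b (.s k) <;> simp [Bool.forall_bool, Bool.exists_bool]

open Classical in
/-- **`f_{n,0}` at a Boolean point is the truth value of the universal prenex formula** with prefix read
off the selector bits and matrix read off the clause-description bits (TV07 Lemma 4.1, first bullet,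
and (4.2)) — the semantic half of its `PSPACE`-hardness. [cite: TrevisanVadhan2007, Lemma 4.1 (ii)] -/
theorem eval_fam_zero_ubv (b : UVar n → Bool) :
    eval (ubv (R := R) b) (fam R n 0) = if HoldsL b (List.finRange n) then 1 else 0 := by
  rw [fam, List.drop_zero, uops]
  exact eval_blocks_ubv _ b

end Family

end QBFUniv

end Literature.Computability.Complexity

end
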